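import Literature.MathematicalPhysics.QuantumLattice.TorusPairSusceptibility
import HarnessLib

/-!
# The Feynman–Bijl and Pitaevskii–Stringari bounds read backwards: a sector gap bounds the structure factor and the static susceptibility

Reproduction (finite-dimensional, `T = 0`) of the elementary spectral inequalities behind the
**Feynman–Bijl single-mode bound** `ω₀ ≤ ⟨[A†,[H,A]]⟩ / ⟨{A†,A}⟩` and the
**Pitaevskii–Stringari bound** `ω₀² ≤ m₁ / m₋₁` (Stringari 1995, §2.3, eqs. (14)–(16); Wagner 1966;
Pitaevskii–Stringari 1991), in the direction *gap ⇒ bound on fluctuations*: if the transition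
vector `v = A ψ` only meets eigenvectors of the Hermitian matrix `K` with eigenvalue `≥ E + ω`,
`ω > 0` (a **gap `ω` above `E` in the sector reached by `A`**), then, with
`S = ‖v‖² = Re ⟨v, v⟩` (static structure factor), `m₁ = Re ⟨v, (K − E) v⟩` (energy-weighted moment;
`½⟨[A†,[H,A]]⟩` after symmetrisation) and `χ = staticSusceptibility K E v = 2 Σ_m |⟨u_m,v⟩|²/(λ_m − E)`
(twice the inverse-energy-weighted moment `m₋₁`, Kato's second-order coefficient, see
`TorusPairSusceptibility.lean`):

* `re_star_dotProduct_self_mul_le_of_gap` : `ω · S ≤ m₁` (Feynman–Bijl read backwards);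
* `staticSusceptibility_mul_le_of_gap` : `ω · χ ≤ 2 S`;
* `staticSusceptibility_mul_sq_le_of_gap` : `ω² · χ ≤ 2 m₁` (Pitaevskii–Stringari read backwards);
* `torusPairSusceptibility_mul_le_of_gap` : the same for the zero-temperature pair susceptibility of
  the fermionic torus in a canonical sector (`torusPairSusceptibility`), with `K = H − μ̄ N̂`.
* `two_mul_first_moment_eq_re_double_commutator` : for `K ψ = E ψ` and Hermitian `X`,
  `2 (Re⟨Xψ, K Xψ⟩ − E Re⟨Xψ, Xψ⟩) = Re ⟨ψ, [X,[K,X]] ψ⟩` (the first moment is half a double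
  commutator; Koma–Tasaki 1994, proof of Thm. 2.2; cf. `tian_double_commutator_expectation` of
  `PairingChannelIdentities.lean`, the `E = 0` case for a general `X`);
* `staticSusceptibility_mul_sq_le_re_double_commutator`,
  `torusPairSusceptibility_mul_sq_le_re_double_commutator` : hence `ω² · χ ≤ Re ⟨ψ, [X,[K,X]] ψ⟩`
  — Pitaevskii–Stringari's `ω₀² ≤ m₁/m₋₁` (Stringari 1995, eq. (15)) with `m₁ = ½⟨[X,[K,X]]⟩`, for
  a sector ground state of the fermionic torus and `X = A + Aᴴ`.
* `sq_sum_le_sum_mul_mul_sum_div` (Cauchy–Schwarz `(Σa)² ≤ (Σ a d)(Σ a/d)`),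
  `two_mul_sq_re_star_dotProduct_self_le` : WITHOUT a gap hypothesis, if `v` only meets eigenvectors
  with eigenvalue `> E`, then `2 (Re⟨v,v⟩)² ≤ m₁ · χ_K(E; v)` — the zero-temperature bound
  `m₀ ≤ (m₁ m₋₁)^{1/2}` (Stringari 1995, §2.2 eq. (10): `S(q) ≤ (∫ω S · ∫ω⁻¹ S)^{1/2}`), the
  engine of the Kennedy–Lieb–Shastry ground-state infrared bound;
* `four_mul_sq_re_le_re_double_commutator_mul_staticSusceptibility`,
  `four_mul_sq_re_le_re_double_commutator_mul_torusPairSusceptibility` : for `K ψ = E ψ` and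
  `v = X ψ`, `4 (Re⟨Xψ,Xψ⟩)² ≤ Re⟨ψ,[X,[K,X]]ψ⟩ · χ`; in particular for the pair susceptibility of a
  sector ground state of the fermionic torus (`X = A + Aᴴ`): an upper bound on `χ_A` of ANY origin
  bounds the pair structure factor through the (local, `O(volume)`) double commutator.

Use (infrared bounds without reflection positivity, *if* one had the gap): for a family of volumes,
a momentum-sector gap `ω_L(q) ≥ c |q|` uniform in `L` for the states `Δ(q) ψ_L` would give
`χ_L(q) ≤ 2 m₁(q) / (c|q|)²`, i.e. an infrared bound of Kennedy–Lieb–Shastry type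
(`XYOrderInfrared.lean`) with `m₁ = O(L²)` a double commutator. No claim is made here that such
gaps are available for any interacting model; the file records the implication only.

Everything is over `ℂ`, `[Fintype n] [DecidableEq n]`, in the `dotProduct`/`mulVec` language of
`TorusPairSusceptibility.lean`; the two spectral sums `Σ_m |⟨u_m,v⟩|² = Re⟨v,v⟩` (Parseval) and
`Σ_m |⟨u_m,v⟩|² λ_m = Re⟨v,Kv⟩` are proved from Mathlib's `Matrix.IsHermitian.spectral_theorem`.
No definition is introduced.

## References

* R. P. Feynman, *Atomic theory of the two-fluid model of liquid helium*, Phys. Rev. 94 (1954) 262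
  (single-mode bound). A. Bijl, Physica 7 (1940) 869.
* H. Wagner, Z. Physik 195 (1966) 273 (bounds of the form (14)).
* L. Pitaevskii, S. Stringari, *Uncertainty principle, quantum fluctuations and broken symmetries*,
  J. Low Temp. Phys. 85 (1991) 377 [PitaevskiiStringari1991].
* S. Stringari, *Bose–Einstein condensation and superfluidity*, in: A. Griffin, D. W. Snoke,
  S. Stringari (eds.), *Bose–Einstein Condensation* (CUP 1995), §2.3, eqs. (14)–(16), p. 75
  [Stringari1995].
* T. Kennedy, E. H. Lieb, B. S. Shastry, J. Stat. Phys. 53 (1988) 1019 (infrared bounds at `T = 0`)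
  [KLS1988].
* T. Koma, H. Tasaki, J. Stat. Phys. 76 (1994) 745, proof of Thm. 2.2 (the double-commutator
  identity) [KomaTasaki1994].
-/

noncomputable section

open Matrix Finset Complex

namespace Literature.MathematicalPhysics.QuantumLattice

section Static

variable {n : Type*} [Fintype n] [DecidableEq n]

/-- The Hermitian matrix in its eigenbasis: `K = U diag(λ) U⋆` with Mathlib's eigenvector unitary
(`Matrix.IsHermitian.spectral_theorem`). [folklore] -/
theorem IsHermitian.eq_conj_diagonal {K : Matrix n n ℂ} (hK : K.IsHermitian) :
    K = (hK.eigenvectorUnitary : Matrix n n ℂ) *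
      diagonal (fun i => ((hK.eigenvalues i : ℝ) : ℂ)) * star (hK.eigenvectorUnitary : Matrix n n ℂ) := by
  conv_lhs => rw [hK.spectral_theorem, Unitary.conjStarAlgAut_apply]
  rfl

/-- **Parseval in the eigenbasis**: `Σ_m |⟨u_m, v⟩|² = Re ⟨v, v⟩` (`= ‖v‖²`). [folklore] -/
theorem sum_norm_sq_eigenvectorBasis_dotProduct {K : Matrix n n ℂ} (hK : K.IsHermitian)
    (v : n → ℂ) :
    ∑ i, ‖star ⇑(hK.eigenvectorBasis i) ⬝ᵥ v‖ ^ 2 = (star v ⬝ᵥ v).re := by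
  have h := star_dotProduct_conj_diagonal_mulVec (hK.eigenvectorUnitary : Matrix n n ℂ)
    (fun _ => (1 : ℂ)) v
  rw [diagonal_one, mul_one, Unitary.mul_star_self_of_mem (hK.eigenvectorUnitary).prop,
    one_mulVec] at h
  have hc : ∀ c : ℂ, star c * c = ((‖c‖ ^ 2 : ℝ) : ℂ) := fun c => by
    rw [Complex.star_def, Complex.conj_mul']; push_cast; rfl
  rw [h, Complex.re_sum]
  refine Finset.sum_congr rfl fun i _ => ?_
  rw [star_eigenvectorUnitary_mulVec_apply, one_mul, hc, Complex.ofReal_re]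

/-- **The Rayleigh quotient as a spectral sum**: `Σ_m |⟨u_m, v⟩|² λ_m = Re ⟨v, K v⟩`. [folklore] -/
theorem sum_norm_sq_eigenvectorBasis_dotProduct_mul_eigenvalues {K : Matrix n n ℂ}
    (hK : K.IsHermitian) (v : n → ℂ) :
    ∑ i, ‖star ⇑(hK.eigenvectorBasis i) ⬝ᵥ v‖ ^ 2 * hK.eigenvalues i = (star v ⬝ᵥ (K *ᵥ v)).re := by
  have h := star_dotProduct_conj_diagonal_mulVec (hK.eigenvectorUnitary : Matrix n n ℂ)
    (fun i => ((hK.eigenvalues i : ℝ) : ℂ)) v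
  rw [← IsHermitian.eq_conj_diagonal hK] at h
  have hc : ∀ c : ℂ, star c * c = ((‖c‖ ^ 2 : ℝ) : ℂ) := fun c => by
    rw [Complex.star_def, Complex.conj_mul']; push_cast; rfl
  rw [h, Complex.re_sum]
  refine Finset.sum_congr rfl fun i _ => ?_
  rw [star_eigenvectorUnitary_mulVec_apply, hc, ← Complex.ofReal_mul, Complex.ofReal_re, mul_comm]

/-- The energy-weighted moment as a spectral sum: `Σ_m |⟨u_m, v⟩|² (λ_m − E) = Re⟨v,Kv⟩ − E·Re⟨v,v⟩`.
[folklore] -/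
theorem sum_norm_sq_eigenvectorBasis_dotProduct_mul_sub {K : Matrix n n ℂ}
    (hK : K.IsHermitian) (E : ℝ) (v : n → ℂ) :
    ∑ i, ‖star ⇑(hK.eigenvectorBasis i) ⬝ᵥ v‖ ^ 2 * (hK.eigenvalues i - E) =
      (star v ⬝ᵥ (K *ᵥ v)).re - E * (star v ⬝ᵥ v).re := by
  simp only [mul_sub, Finset.sum_sub_distrib,
    sum_norm_sq_eigenvectorBasis_dotProduct_mul_eigenvalues hK v]
  rw [← Finset.sum_mul, sum_norm_sq_eigenvectorBasis_dotProduct hK v, mul_comm]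

/-- **Feynman–Bijl read backwards: a sector gap bounds the structure factor by the first moment.**
If `v` only meets eigenvectors of `K` with eigenvalue `≥ E + ω` (any real `ω`), then
`ω · Re⟨v,v⟩ ≤ Re⟨v,Kv⟩ − E · Re⟨v,v⟩` (`ω S ≤ m₁`).
[cite: Stringari1995, §2.3 eq. (16)] -/
theorem re_star_dotProduct_self_mul_le_of_gap {K : Matrix n n ℂ} (hK : K.IsHermitian)
    {E ω : ℝ} {v : n → ℂ}
    (h : ∀ i, E + ω ≤ hK.eigenvalues i ∨ star ⇑(hK.eigenvectorBasis i) ⬝ᵥ v = 0) :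
    ω * (star v ⬝ᵥ v).re ≤ (star v ⬝ᵥ (K *ᵥ v)).re - E * (star v ⬝ᵥ v).re := by
  rw [← sum_norm_sq_eigenvectorBasis_dotProduct_mul_sub hK E v,
    ← sum_norm_sq_eigenvectorBasis_dotProduct hK v, Finset.mul_sum]
  refine Finset.sum_le_sum fun i _ => ?_
  rcases h i with hi | hi
  · rw [mul_comm]
    exact mul_le_mul_of_nonneg_left (by linarith) (sq_nonneg _)
  · simp [hi]

/-- **A sector gap bounds the static susceptibility by the structure factor**: under the same
hypothesis `ω · χ_K(E; v) ≤ 2 Re⟨v,v⟩` (each term `|⟨u_m,v⟩|²/(λ_m − E) ≤ |⟨u_m,v⟩|²/ω`).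
[cite: Stringari1995, §2.3 eq. (15)] -/
theorem staticSusceptibility_mul_le_of_gap {K : Matrix n n ℂ} (hK : K.IsHermitian)
    {E ω : ℝ} (hω : 0 < ω) {v : n → ℂ}
    (h : ∀ i, E + ω ≤ hK.eigenvalues i ∨ star ⇑(hK.eigenvectorBasis i) ⬝ᵥ v = 0) :
    ω * staticSusceptibility K E v ≤ 2 * (star v ⬝ᵥ v).re := by
  rw [staticSusceptibility_eq_sum hK, ← sum_norm_sq_eigenvectorBasis_dotProduct hK v,
    mul_left_comm, Finset.mul_sum]
  refine mul_le_mul_of_nonneg_left (Finset.sum_le_sum fun i _ => ?_) zero_le_two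
  rcases h i with hi | hi
  · have hpos : 0 < hK.eigenvalues i - E := by linarith
    rw [mul_div_assoc', div_le_iff₀ hpos, mul_comm]
    exact mul_le_mul_of_nonneg_left (by linarith) (sq_nonneg _)
  · simp [hi]

/-- **Pitaevskii–Stringari read backwards: a sector gap bounds the static susceptibility by the
first moment**, `ω² · χ_K(E; v) ≤ 2 (Re⟨v,Kv⟩ − E · Re⟨v,v⟩)` (`ω² m₋₁ ≤ m₁`).
[cite: Stringari1995, §2.3 eq. (15)] -/
theorem staticSusceptibility_mul_sq_le_of_gap {K : Matrix n n ℂ} (hK : K.IsHermitian)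
    {E ω : ℝ} (hω : 0 < ω) {v : n → ℂ}
    (h : ∀ i, E + ω ≤ hK.eigenvalues i ∨ star ⇑(hK.eigenvectorBasis i) ⬝ᵥ v = 0) :
    ω ^ 2 * staticSusceptibility K E v ≤
      2 * ((star v ⬝ᵥ (K *ᵥ v)).re - E * (star v ⬝ᵥ v).re) := by
  have h1 := staticSusceptibility_mul_le_of_gap hK hω h
  have h2 := re_star_dotProduct_self_mul_le_of_gap hK h
  calc ω ^ 2 * staticSusceptibility K E v = ω * (ω * staticSusceptibility K E v) := by ring
    _ ≤ ω * (2 * (star v ⬝ᵥ v).re) := mul_le_mul_of_nonneg_left h1 hω.le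
    _ = 2 * (ω * (star v ⬝ᵥ v).re) := by ring
    _ ≤ 2 * ((star v ⬝ᵥ (K *ᵥ v)).re - E * (star v ⬝ᵥ v).re) :=
        mul_le_mul_of_nonneg_left h2 zero_le_two

end Static

/-! ### The torus pair susceptibility under a pair gap -/

section Torus

variable {L : ℕ}
variable {H : Matrix (Finset (Orb (FermionTorus 2 L))) (Finset (Orb (FermionTorus 2 L))) ℂ}
  (A : Matrix (Finset (Orb (FermionTorus 2 L))) (Finset (Orb (FermionTorus 2 L))) ℂ) {N : ℕ}
  (ψ : Fock (Orb (FermionTorus 2 L)))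

/-- **A uniform gap in the pair sectors bounds the torus pair susceptibility by the pair structure
factor.** With `K = H − μ̄ N̂`, `E = E₀(N) − μ̄ N` as in `torusPairSusceptibility`: if the transition
vector `(A + Aᴴ)ψ` only meets eigenvectors of `K` with `E^K_m ≥ E + ω`, `0 < ω` (for a
sector-conserving `H` and a pair operator `A`: the lowest `(N ± 2)`-particle states reached by
`A`, `Aᴴ` lie `≥ ω` above the sector ground energy in the `K`-frame, i.e. a pair gap beyond
`pairGap H N`), then `ω · χ_A(ψ) ≤ 2 ‖(A + Aᴴ)ψ‖²`. This is the zero-temperature single-mode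
(Feynman–Bijl / Pitaevskii–Stringari) inequality read as an upper bound on the response.
[cite: Stringari1995, §2.3 eq. (15)–(16)] -/
theorem torusPairSusceptibility_mul_le_of_gap
    (hK : (H - (pairChemicalPotential H N : ℂ) •
      (totalNumber : Matrix (Finset (Orb (FermionTorus 2 L))) _ ℂ)).IsHermitian)
    {ω : ℝ} (hω : 0 < ω)
    (h : ∀ m, H.minEnergyOn (szSector N 0) - pairChemicalPotential H N * N + ω ≤ hK.eigenvalues m ∨
      star ⇑(hK.eigenvectorBasis m) ⬝ᵥ ((A + Aᴴ) *ᵥ ψ) = 0) :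
    ω * torusPairSusceptibility H A N ψ ≤
      2 * (star ((A + Aᴴ) *ᵥ ψ) ⬝ᵥ ((A + Aᴴ) *ᵥ ψ)).re :=
  staticSusceptibility_mul_le_of_gap hK hω h

/-- The first-moment form on the torus: `ω² · χ_A(ψ) ≤ 2 (Re⟨v, K v⟩ − E · Re⟨v, v⟩)`,
`v = (A + Aᴴ)ψ`, `K = H − μ̄ N̂`, `E = E₀(N) − μ̄ N`. [cite: Stringari1995, §2.3 eq. (15)] -/
theorem torusPairSusceptibility_mul_sq_le_of_gap
    (hK : (H - (pairChemicalPotential H N : ℂ) •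
      (totalNumber : Matrix (Finset (Orb (FermionTorus 2 L))) _ ℂ)).IsHermitian)
    {ω : ℝ} (hω : 0 < ω)
    (h : ∀ m, H.minEnergyOn (szSector N 0) - pairChemicalPotential H N * N + ω ≤ hK.eigenvalues m ∨
      star ⇑(hK.eigenvectorBasis m) ⬝ᵥ ((A + Aᴴ) *ᵥ ψ) = 0) :
    ω ^ 2 * torusPairSusceptibility H A N ψ ≤
      2 * ((star ((A + Aᴴ) *ᵥ ψ) ⬝ᵥ
            ((H - (pairChemicalPotential H N : ℂ) • totalNumber) *ᵥ ((A + Aᴴ) *ᵥ ψ))).re -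
          (H.minEnergyOn (szSector N 0) - pairChemicalPotential H N * N) *
            (star ((A + Aᴴ) *ᵥ ψ) ⬝ᵥ ((A + Aᴴ) *ᵥ ψ)).re) :=
  staticSusceptibility_mul_sq_le_of_gap hK hω h

end Torus

/-! ### The first moment as a double commutator (Koma–Tasaki / Pitaevskii–Stringari) -/
section DoubleCommutator

variable {n : Type*} [Fintype n] [DecidableEq n]

omit [DecidableEq n] in
/-- **The first moment is half a double commutator.** For Hermitian `K`, `X` and an eigenvector
`K ψ = E ψ`: `2 (Re⟨Xψ, K Xψ⟩ − E · Re⟨Xψ, Xψ⟩) = Re ⟨ψ, [X,[K,X]] ψ⟩`, the double commutator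
written `X (K X − X K) − (K X − X K) X`. (Koma–Tasaki 1994, proof of Thm. 2.2.)
[cite: KomaTasaki1994, proof of Thm. 2.2] -/
theorem two_mul_first_moment_eq_re_double_commutator {K X : Matrix n n ℂ} (hK : K.IsHermitian)
    (hX : X.IsHermitian) {E : ℝ} {ψ : n → ℂ} (hψ : K *ᵥ ψ = (E : ℂ) • ψ) :
    2 * ((star (X *ᵥ ψ) ⬝ᵥ (K *ᵥ (X *ᵥ ψ))).re - E * (star (X *ᵥ ψ) ⬝ᵥ (X *ᵥ ψ)).re) =
      (star ψ ⬝ᵥ ((X * (K * X - X * K) - (K * X - X * K) * X) *ᵥ ψ)).re := by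
  -- move `X` (Hermitian) and `K` (Hermitian, `K ψ = E ψ`) from `ψ` on the left to the right
  have hXψ : ∀ w, star ψ ⬝ᵥ (X *ᵥ w) = star (X *ᵥ ψ) ⬝ᵥ w := fun w => by
    rw [star_dotProduct_mulVec, hX.eq]
  have hKψ : ∀ w, star ψ ⬝ᵥ (K *ᵥ w) = (E : ℂ) * (star ψ ⬝ᵥ w) := fun w => by
    rw [star_dotProduct_mulVec, hK.eq, hψ, star_smul, smul_dotProduct, smul_eq_mul,
      Complex.star_def, Complex.conj_ofReal]
  -- expand the double commutator on `ψ`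
  have hvec : (X * (K * X - X * K) - (K * X - X * K) * X) *ᵥ ψ =
      (X *ᵥ (K *ᵥ (X *ᵥ ψ)) - (E : ℂ) • (X *ᵥ (X *ᵥ ψ))) -
        (K *ᵥ (X *ᵥ (X *ᵥ ψ)) - X *ᵥ (K *ᵥ (X *ᵥ ψ))) := by
    simp only [mul_sub, sub_mul, sub_mulVec, ← mulVec_mulVec, hψ, mulVec_smul]
  simp only [hvec, dotProduct_sub, dotProduct_smul, hXψ, hKψ, smul_eq_mul, Complex.sub_re,
    Complex.re_ofReal_mul]
  ring

/-- **Pitaevskii–Stringari at `T = 0`, gap form**: if `K ψ = E ψ`, `X` is Hermitian and `X ψ` only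
meets eigenvectors of `K` with eigenvalue `≥ E + ω`, `0 < ω`, then
`ω² · χ_K(E; Xψ) ≤ Re ⟨ψ, [X,[K,X]] ψ⟩` (`ω₀² ≤ m₁/m₋₁` read backwards).
[cite: Stringari1995, §2.3 eq. (15)] -/
theorem staticSusceptibility_mul_sq_le_re_double_commutator {K X : Matrix n n ℂ}
    (hK : K.IsHermitian) (hX : X.IsHermitian) {E ω : ℝ} (hω : 0 < ω) {ψ : n → ℂ}
    (hψ : K *ᵥ ψ = (E : ℂ) • ψ)
    (h : ∀ i, E + ω ≤ hK.eigenvalues i ∨ star ⇑(hK.eigenvectorBasis i) ⬝ᵥ (X *ᵥ ψ) = 0) :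
    ω ^ 2 * staticSusceptibility K E (X *ᵥ ψ) ≤
      (star ψ ⬝ᵥ ((X * (K * X - X * K) - (K * X - X * K) * X) *ᵥ ψ)).re := by
  rw [← two_mul_first_moment_eq_re_double_commutator hK hX hψ]
  exact staticSusceptibility_mul_sq_le_of_gap hK hω h

end DoubleCommutator

/-! ### The torus pair susceptibility under a pair gap: double-commutator form -/

section TorusDoubleCommutator

variable {L : ℕ}
variable {H : Matrix (Finset (Orb (FermionTorus 2 L))) (Finset (Orb (FermionTorus 2 L))) ℂ}
  (A : Matrix (Finset (Orb (FermionTorus 2 L))) (Finset (Orb (FermionTorus 2 L))) ℂ) {N : ℕ}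
  {ψ : Fock (Orb (FermionTorus 2 L))}

/-- **A pair gap bounds the torus pair susceptibility by a double commutator.** For a Hermitian
`H`, a ground state `ψ` of `H` in the sector `(N, S^z = 0)` and any `A`, with `X = A + Aᴴ`,
`K = H − μ̄ N̂` (`μ̄ = pairChemicalPotential H N`) and `E = E₀(N) − μ̄ N`: if `X ψ` only meets
eigenvectors of `K` with eigenvalue `≥ E + ω`, `0 < ω`, then
`ω² · χ_A(ψ) ≤ Re ⟨ψ, [X,[K,X]] ψ⟩`. [cite: Stringari1995, §2.3 eq. (15)] -/
theorem torusPairSusceptibility_mul_sq_le_re_double_commutator (hH : H.IsHermitian)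
    (hψ : IsGroundStateInSector H N 0 ψ) {ω : ℝ} (hω : 0 < ω)
    (h : ∀ m, H.minEnergyOn (szSector N 0) - pairChemicalPotential H N * N + ω ≤
        (isHermitian_sub_smul_totalNumber hH (pairChemicalPotential H N)).eigenvalues m ∨
      star ⇑((isHermitian_sub_smul_totalNumber hH (pairChemicalPotential H N)).eigenvectorBasis m)
        ⬝ᵥ ((A + Aᴴ) *ᵥ ψ) = 0) :
    ω ^ 2 * torusPairSusceptibility H A N ψ ≤
      (star ψ ⬝ᵥ (((A + Aᴴ) *
          ((H - (pairChemicalPotential H N : ℂ) • totalNumber) * (A + Aᴴ) -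
            (A + Aᴴ) * (H - (pairChemicalPotential H N : ℂ) • totalNumber)) -
        ((H - (pairChemicalPotential H N : ℂ) • totalNumber) * (A + Aᴴ) -
            (A + Aᴴ) * (H - (pairChemicalPotential H N : ℂ) • totalNumber)) * (A + Aᴴ)) *ᵥ ψ)).re :=
  staticSusceptibility_mul_sq_le_re_double_commutator
    (isHermitian_sub_smul_totalNumber hH _) (isHermitian_add_transpose_self A) hω
    (sub_smul_totalNumber_mulVec_of_isGroundStateInSector hψ _) h

end TorusDoubleCommutator


/-! ### Without a gap: `m₀² ≤ m₁ m₋₁` (the Kennedy–Lieb–Shastry / Pitaevskii–Stringari engine) -/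

section CauchySchwarz

/-- **Cauchy–Schwarz for spectral moments**: if for every index either `d i > 0 ≤ a i` or `a i = 0`,
then `(Σ a)² ≤ (Σ a·d) · (Σ a/d)` (write `a = √(a d) · √(a/d)`). [folklore] -/
theorem sq_sum_le_sum_mul_mul_sum_div {ι : Type*} (s : Finset ι) {a d : ι → ℝ}
    (h : ∀ i ∈ s, (0 < d i ∧ 0 ≤ a i) ∨ a i = 0) :
    (∑ i ∈ s, a i) ^ 2 ≤ (∑ i ∈ s, a i * d i) * ∑ i ∈ s, a i / d i := by
  have hfg : ∀ i ∈ s, Real.sqrt (a i * d i) * Real.sqrt (a i / d i) = a i := by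
    intro i hi
    rcases h i hi with ⟨hd, ha⟩ | ha
    · have hprod : a i * d i * (a i / d i) = a i * a i := by
        rw [mul_assoc, ← mul_div_assoc, mul_div_cancel_left₀ _ hd.ne']
      rw [← Real.sqrt_mul (mul_nonneg ha hd.le), hprod, Real.sqrt_mul_self ha]
    · simp [ha]
  have hf : ∀ i ∈ s, Real.sqrt (a i * d i) ^ 2 = a i * d i := by
    intro i hi
    rcases h i hi with ⟨hd, ha⟩ | ha
    · exact Real.sq_sqrt (mul_nonneg ha hd.le)
    · simp [ha]
  have hg : ∀ i ∈ s, Real.sqrt (a i / d i) ^ 2 = a i / d i := by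
    intro i hi
    rcases h i hi with ⟨hd, ha⟩ | ha
    · exact Real.sq_sqrt (div_nonneg ha hd.le)
    · simp [ha]
  calc (∑ i ∈ s, a i) ^ 2
      = (∑ i ∈ s, Real.sqrt (a i * d i) * Real.sqrt (a i / d i)) ^ 2 := by
        rw [Finset.sum_congr rfl hfg]
    _ ≤ (∑ i ∈ s, Real.sqrt (a i * d i) ^ 2) * ∑ i ∈ s, Real.sqrt (a i / d i) ^ 2 :=
        Finset.sum_mul_sq_le_sq_mul_sq s _ _
    _ = (∑ i ∈ s, a i * d i) * ∑ i ∈ s, a i / d i := by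
        rw [Finset.sum_congr rfl hf, Finset.sum_congr rfl hg]

variable {n : Type*} [Fintype n] [DecidableEq n]

/-- **`m₀² ≤ m₁ m₋₁` at zero temperature** (no gap needed): if `v` only meets eigenvectors of the
Hermitian `K` with eigenvalue `> E`, then `2 (Re⟨v,v⟩)² ≤ (Re⟨v,Kv⟩ − E·Re⟨v,v⟩) · χ_K(E; v)`
(`χ = 2 m₋₁`). Stringari (1995), §2.2 eq. (10): `S(q) ≤ (∫ω S(q,ω) · ∫ω⁻¹ S(q,ω))^{1/2}`; the
engine of the Kennedy–Lieb–Shastry ground-state infrared bound.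
[cite: Stringari1995, §2.2 eq. (10)] -/
theorem two_mul_sq_re_star_dotProduct_self_le {K : Matrix n n ℂ} (hK : K.IsHermitian) {E : ℝ}
    {v : n → ℂ} (h : ∀ i, E < hK.eigenvalues i ∨ star ⇑(hK.eigenvectorBasis i) ⬝ᵥ v = 0) :
    2 * (star v ⬝ᵥ v).re ^ 2 ≤
      ((star v ⬝ᵥ (K *ᵥ v)).re - E * (star v ⬝ᵥ v).re) * staticSusceptibility K E v := by
  rw [← sum_norm_sq_eigenvectorBasis_dotProduct_mul_sub hK E v,
    ← sum_norm_sq_eigenvectorBasis_dotProduct hK v, staticSusceptibility_eq_sum hK, Finset.mul_sum]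
  have hcs : (∑ i, ‖star ⇑(hK.eigenvectorBasis i) ⬝ᵥ v‖ ^ 2) ^ 2 ≤
      (∑ i, ‖star ⇑(hK.eigenvectorBasis i) ⬝ᵥ v‖ ^ 2 * (hK.eigenvalues i - E)) *
        ∑ i, ‖star ⇑(hK.eigenvectorBasis i) ⬝ᵥ v‖ ^ 2 / (hK.eigenvalues i - E) :=
    sq_sum_le_sum_mul_mul_sum_div Finset.univ fun i _ => by
      rcases h i with hi | hi
      · exact Or.inl ⟨sub_pos.2 hi, sq_nonneg _⟩
      · exact Or.inr (by rw [hi, norm_zero, sq, mul_zero])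
  calc 2 * (∑ i, ‖star ⇑(hK.eigenvectorBasis i) ⬝ᵥ v‖ ^ 2) ^ 2
      ≤ 2 * ((∑ i, ‖star ⇑(hK.eigenvectorBasis i) ⬝ᵥ v‖ ^ 2 * (hK.eigenvalues i - E)) *
          ∑ i, ‖star ⇑(hK.eigenvectorBasis i) ⬝ᵥ v‖ ^ 2 / (hK.eigenvalues i - E)) :=
        mul_le_mul_of_nonneg_left hcs zero_le_two
    _ = (∑ i, ‖star ⇑(hK.eigenvectorBasis i) ⬝ᵥ v‖ ^ 2 * (hK.eigenvalues i - E)) *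
          ∑ i, 2 * (‖star ⇑(hK.eigenvectorBasis i) ⬝ᵥ v‖ ^ 2 / (hK.eigenvalues i - E)) := by
        rw [← Finset.mul_sum]; ring

/-- **Kennedy–Lieb–Shastry at `T = 0`, double-commutator form**: for Hermitian `K`, `X`, an
eigenvector `K ψ = E ψ` such that `X ψ` only meets eigenvectors with eigenvalue `> E`,
`4 (Re⟨Xψ, Xψ⟩)² ≤ Re⟨ψ, [X,[K,X]] ψ⟩ · χ_K(E; Xψ)` — the structure factor is bounded by the
geometric mean of the (local) double commutator and the static susceptibility.
[cite: Stringari1995, §2.2 eq. (10)] [cite: KomaTasaki1994, proof of Thm. 2.2] -/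
theorem four_mul_sq_re_le_re_double_commutator_mul_staticSusceptibility {K X : Matrix n n ℂ}
    (hK : K.IsHermitian) (hX : X.IsHermitian) {E : ℝ} {ψ : n → ℂ} (hψ : K *ᵥ ψ = (E : ℂ) • ψ)
    (h : ∀ i, E < hK.eigenvalues i ∨ star ⇑(hK.eigenvectorBasis i) ⬝ᵥ (X *ᵥ ψ) = 0) :
    4 * (star (X *ᵥ ψ) ⬝ᵥ (X *ᵥ ψ)).re ^ 2 ≤
      (star ψ ⬝ᵥ ((X * (K * X - X * K) - (K * X - X * K) * X) *ᵥ ψ)).re *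
        staticSusceptibility K E (X *ᵥ ψ) := by
  rw [← two_mul_first_moment_eq_re_double_commutator hK hX hψ]
  have h2 := two_mul_sq_re_star_dotProduct_self_le hK h
  calc 4 * (star (X *ᵥ ψ) ⬝ᵥ (X *ᵥ ψ)).re ^ 2 = 2 * (2 * (star (X *ᵥ ψ) ⬝ᵥ (X *ᵥ ψ)).re ^ 2) := by
        ring
    _ ≤ 2 * (((star (X *ᵥ ψ) ⬝ᵥ (K *ᵥ (X *ᵥ ψ))).re - E * (star (X *ᵥ ψ) ⬝ᵥ (X *ᵥ ψ)).re) *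
          staticSusceptibility K E (X *ᵥ ψ)) := mul_le_mul_of_nonneg_left h2 zero_le_two
    _ = _ := by ring

end CauchySchwarz

section TorusCauchySchwarz

variable {L : ℕ}
variable {H : Matrix (Finset (Orb (FermionTorus 2 L))) (Finset (Orb (FermionTorus 2 L))) ℂ}
  (A : Matrix (Finset (Orb (FermionTorus 2 L))) (Finset (Orb (FermionTorus 2 L))) ℂ) {N : ℕ}
  {ψ : Fock (Orb (FermionTorus 2 L))}

/-- **Kennedy–Lieb–Shastry at `T = 0` for the torus pair susceptibility.** For a Hermitian `H`, a
ground state `ψ` of `H` in the sector `(N, S^z = 0)` and any `A`, with `X = A + Aᴴ`,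
`K = H − μ̄ N̂` and `E = E₀(N) − μ̄ N`: if `X ψ` only meets eigenvectors of `K` with eigenvalue
`> E`, then `4 (Re⟨Xψ, Xψ⟩)² ≤ Re⟨ψ, [X,[K,X]] ψ⟩ · χ_A(ψ)` — any upper bound on the pair
susceptibility bounds the pair structure factor. [cite: Stringari1995, §2.2 eq. (10)] -/
theorem four_mul_sq_re_le_re_double_commutator_mul_torusPairSusceptibility (hH : H.IsHermitian)
    (hψ : IsGroundStateInSector H N 0 ψ)
    (h : ∀ m, H.minEnergyOn (szSector N 0) - pairChemicalPotential H N * N <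
        (isHermitian_sub_smul_totalNumber hH (pairChemicalPotential H N)).eigenvalues m ∨
      star ⇑((isHermitian_sub_smul_totalNumber hH (pairChemicalPotential H N)).eigenvectorBasis m)
        ⬝ᵥ ((A + Aᴴ) *ᵥ ψ) = 0) :
    4 * (star ((A + Aᴴ) *ᵥ ψ) ⬝ᵥ ((A + Aᴴ) *ᵥ ψ)).re ^ 2 ≤
      (star ψ ⬝ᵥ (((A + Aᴴ) *
          ((H - (pairChemicalPotential H N : ℂ) • totalNumber) * (A + Aᴴ) -
            (A + Aᴴ) * (H - (pairChemicalPotential H N : ℂ) • totalNumber)) -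
        ((H - (pairChemicalPotential H N : ℂ) • totalNumber) * (A + Aᴴ) -
            (A + Aᴴ) * (H - (pairChemicalPotential H N : ℂ) • totalNumber)) * (A + Aᴴ)) *ᵥ ψ)).re *
        torusPairSusceptibility H A N ψ :=
  four_mul_sq_re_le_re_double_commutator_mul_staticSusceptibility
    (isHermitian_sub_smul_totalNumber hH _) (isHermitian_add_transpose_self A)
    (sub_smul_totalNumber_mulVec_of_isGroundStateInSector hψ _) h

end TorusCauchySchwarz


end Literature.MathematicalPhysics.QuantumLattice
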